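import Mathlib
import HarnessLib
import Summits.HubbardSuperconductivity.HubbardSuperconductivity.Theorems.KLProgrammeKLRegimeEngineV8TwoLegGridSpectatorFamily
import Literature.MathematicalPhysics.QuantumLattice.GrassmannSpectatorTruncation

/-!
# Route `KLProgramme` — ENGINE child gen 8 (stmt-HubbardSuperconductivity-20437 `KLRegimeEngineV17F2`), class #7 in GRID currency ((Y′)-GRID), deliverable
# W3 «plain-leg m = 2 read-out pass»: the door ON THE TRUNCATED VERTEX — the grid increment's pieces at any spectator string = the pieces of the tower's
# sectorised step acting on `(Ψ_p W_j[K])♭_k`, the part of the spectator vertex with at most `k` plain legs (cell gate-hubbard-kl, seat hubbard-kl-k3c2-p3 g7)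

THE FINAL SHAPE OF THE W3 STEP.  `…TwoLegGridSpectatorFamily` (p569499) reads `kernel_m (W_{j+1}[K] − W_j[K]) (p ∘ a)` as the all-spectator kernel of ONE step in
`Γ_sec ⊕ ρ` with covariance `B = fromBlocks (S(F̃)ᵀ C^K_{(Λ_{j+1},Λ_j]} S(F̃)) 0 0 0` on `Ψ_p W_j[K]`; `GrassmannSpectatorTruncation` (Literature) shows that an output
with at most `k` spectator legs sees only `V♭_k`, the truncation of the vertex to kernels with at most `k` spectator legs (`B` has no line at a spectator).
Composed here: with `k ≥ m` (two-leg read-out: `m = k = 2`),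
`kernel_m (W_{j+1}[K] − W_j[K]) (p ∘ a) = kernel_m (Δ_B V♭) (inr∘a) + kernel_m (e^{Δ_B}V♭ − V♭ − Δ_B V♭) (inr∘a) + kernel_m (effAction B V♭ − e^{Δ_B}V♭) (inr∘a)`,
`V♭ = (Ψ_p W_j[K])♭_k` — so the ABSTRACT weighted cluster / Gram / Laplacian bounds of the tree apply to `V♭`, whose anchored norms are EXACTLY the «mixed norms with
≤ k plain legs» (`sum_mul_norm_kernel_spectatorTrunc`; sector legs of `Ψ_p W_j[K]` = `sectorPreimage β F 𝒱⁽ʲ⁾[K]`, spectator legs = plain grid legs of `W_j[K]`).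

* **`kernel_gridEffAction_succ_sub_eq_spectator_trunc`** — the statement above (any `ρ`, `p`, `a`, `k ≥ m`; `ρ = GridLeg`, `p = id` for the pinned `L¹` output sum).
* `card_filter_isRight_inr_comp` — an all-spectator string of length `m` has `m` spectator legs.

Exact identities; no estimate, no definition; nothing about the model's sizes is asserted; nothing asserts superconductivity.
References: BGM 2006 §2.2 (2.12), §2.3 (2.17), §2.7 (2.66)–(2.71) [cite: BenfattoGiulianiMastropietro2006]; Salmhofer 1999 App. B.2 [cite: Salmhofer1999].
-/

noncomputable section

namespace Summit.HubbardSuperconductivity.HubbardSuperconductivity.Theorems.EngineV8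

set_option linter.dupNamespace false -- summit = problem name (single-conjunct summit), D-0017

open Real Finset Literature.MathematicalPhysics.QuantumLattice Literature.Probability.LatticeModels
open Literature.Probability.LatticeModels.BattleFederbush GrassmannAlgebra
open Summit.HubbardSuperconductivity.HubbardSuperconductivity.Theorems.KLRegimeSplit
open Summit.HubbardSuperconductivity.HubbardSuperconductivity.Theorems.KLProgrammeLegKernels

section Model

variable {L M : ℕ} [NeZero L] [NeZero M] {N : ℕ} {ρ : Type*} [Fintype ρ] [DecidableEq ρ]

omit [Fintype ρ] [DecidableEq ρ] in
/-- An all-spectator string of length `m` has exactly `m` spectator legs. -/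
theorem card_filter_isRight_inr_comp {Γ : Type*} {m : ℕ} (a : Fin m → ρ) :
    ((univ : Finset (Fin m)).filter (fun i => ((Sum.inr ∘ a : Fin m → Γ ⊕ ρ) i).isRight)).card = m := by
  have h : ((univ : Finset (Fin m)).filter (fun i => ((Sum.inr ∘ a : Fin m → Γ ⊕ ρ) i).isRight)) = univ :=
    Finset.filter_true_of_mem fun i _ => rfl
  rw [h, card_univ, Fintype.card_fin]

/-- **THE GRID INCREMENT THROUGH THE TRUNCATED SPECTATOR VERTEX** (`β ≠ 0`, `Z^K_{Λ_j} ≠ 0`, `F̃F = F`, plateau of `F` over the slice; any `ρ`, `p`, `a`, `m ≤ k`):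
with `Mb = (ε_x • E(F)) S_{4M}`, `D = S(F̃)ᵀ C^K_{(Λ_{j+1},Λ_j]} S(F̃)`, `B = fromBlocks D 0 0 0`, `V = Ψ_p W_j[K]`, `V♭ = V♭_k` (kernels of `V` with ≤ k spectator legs):
`kernel_m (W_{j+1}[K] − W_j[K]) (p ∘ a) = kernel_m (Δ_B V♭) (inr ∘ a) + kernel_m (e^{Δ_B}V♭ − V♭ − Δ_B V♭) (inr ∘ a) + kernel_m (effAction B V♭ − e^{Δ_B}V♭) (inr ∘ a)`. -/
theorem kernel_gridEffAction_succ_sub_eq_spectator_trunc {β : ℝ} (hβ : β ≠ 0) (U μ : ℝ) (K : TrigPolyC4v) (j : ℕ)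
    (hZ : hubbardEffPartitionFnCT L M β U μ 0 K (klScale klE0 j) ≠ 0) (F Ft : Fin N → FreqMomentum L M → ℂ) (hFF : ∀ ω k, Ft ω k * F ω k = F ω k)
    (hCpl : ∀ X Y, hubbardCovSliceCT L M β μ 0 K (klScale klE0 (j + 1)) (klScale klE0 j) X Y ≠ 0 → ∑ ω, F ω X.1.1 = 1 ∧ ∑ ω, F ω Y.1.1 = 1)
    (p : ρ → GridLeg (GridPoint L (2 * (2 * M)))) {m k : ℕ} (hmk : m ≤ k) (a : Fin m → ρ) :
    kernel ℂ
        (effAction ℂ ((hubbardGridSub L M β (2 * (2 * M))).transpose *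
            hubbardCovAboveCT L M β μ 0 K (klScale klE0 (j + 1)) * hubbardGridSub L M β (2 * (2 * M)))
          (hubbardGridInteraction L (2 * (2 * M)) β U + hubbardGridCounterQuadratic L (2 * (2 * M)) β K) -
        effAction ℂ ((hubbardGridSub L M β (2 * (2 * M))).transpose *
            hubbardCovAboveCT L M β μ 0 K (klScale klE0 j) * hubbardGridSub L M β (2 * (2 * M)))
          (hubbardGridInteraction L (2 * (2 * M)) β U + hubbardGridCounterQuadratic L (2 * (2 * M)) β K)) m (p ∘ a) =
      kernel ℂ (grassmannLaplacian ℂ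
          (Matrix.fromBlocks ((sectorSubMatrix L M β Ft).transpose * hubbardCovSliceCT L M β μ 0 K (klScale klE0 (j + 1)) (klScale klE0 j) *
              sectorSubMatrix L M β Ft) (0 : Matrix (SpaceTimeIdx L M × SectorLeg N) ρ ℂ)
            (0 : Matrix ρ (SpaceTimeIdx L M × SectorLeg N) ℂ) (0 : Matrix ρ ρ ℂ))
          (∑ m' ∈ range (Fintype.card ((SpaceTimeIdx L M × SectorLeg N) ⊕ ρ) + 1), presented ℂ
            (fun Y : Fin m' → (SpaceTimeIdx L M × SectorLeg N) ⊕ ρ =>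
              if ((univ : Finset (Fin m')).filter (fun i => (Y i).isRight)).card ≤ k then
                kernel ℂ (ExteriorAlgebra.map (Matrix.toLin' (Matrix.fromRows
                    ((((imagTimeWeight β M : ℝ) : ℂ)) • sectorAnalysisMatrix L M β F * hubbardGridSub L M β (2 * (2 * M)))
                    (Matrix.of fun b q => if p b = q then (1 : ℂ) else 0)))
                  (effAction ℂ ((hubbardGridSub L M β (2 * (2 * M))).transpose *
                      hubbardCovAboveCT L M β μ 0 K (klScale klE0 j) * hubbardGridSub L M β (2 * (2 * M)))
                    (hubbardGridInteraction L (2 * (2 * M)) β U + hubbardGridCounterQuadratic L (2 * (2 * M)) β K))) m' Y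
              else 0))) m (Sum.inr ∘ a) +
      kernel ℂ (gaussConv ℂ
            (Matrix.fromBlocks ((sectorSubMatrix L M β Ft).transpose * hubbardCovSliceCT L M β μ 0 K (klScale klE0 (j + 1)) (klScale klE0 j) *
                sectorSubMatrix L M β Ft) (0 : Matrix (SpaceTimeIdx L M × SectorLeg N) ρ ℂ)
              (0 : Matrix ρ (SpaceTimeIdx L M × SectorLeg N) ℂ) (0 : Matrix ρ ρ ℂ))
            (∑ m' ∈ range (Fintype.card ((SpaceTimeIdx L M × SectorLeg N) ⊕ ρ) + 1), presented ℂ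
              (fun Y : Fin m' → (SpaceTimeIdx L M × SectorLeg N) ⊕ ρ =>
                if ((univ : Finset (Fin m')).filter (fun i => (Y i).isRight)).card ≤ k then
                  kernel ℂ (ExteriorAlgebra.map (Matrix.toLin' (Matrix.fromRows
                      ((((imagTimeWeight β M : ℝ) : ℂ)) • sectorAnalysisMatrix L M β F * hubbardGridSub L M β (2 * (2 * M)))
                      (Matrix.of fun b q => if p b = q then (1 : ℂ) else 0)))
                    (effAction ℂ ((hubbardGridSub L M β (2 * (2 * M))).transpose *
                        hubbardCovAboveCT L M β μ 0 K (klScale klE0 j) * hubbardGridSub L M β (2 * (2 * M)))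
                      (hubbardGridInteraction L (2 * (2 * M)) β U + hubbardGridCounterQuadratic L (2 * (2 * M)) β K))) m' Y
                else 0)) -
          (∑ m' ∈ range (Fintype.card ((SpaceTimeIdx L M × SectorLeg N) ⊕ ρ) + 1), presented ℂ
              (fun Y : Fin m' → (SpaceTimeIdx L M × SectorLeg N) ⊕ ρ =>
                if ((univ : Finset (Fin m')).filter (fun i => (Y i).isRight)).card ≤ k then
                  kernel ℂ (ExteriorAlgebra.map (Matrix.toLin' (Matrix.fromRows
                      ((((imagTimeWeight β M : ℝ) : ℂ)) • sectorAnalysisMatrix L M β F * hubbardGridSub L M β (2 * (2 * M)))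
                      (Matrix.of fun b q => if p b = q then (1 : ℂ) else 0)))
                    (effAction ℂ ((hubbardGridSub L M β (2 * (2 * M))).transpose *
                        hubbardCovAboveCT L M β μ 0 K (klScale klE0 j) * hubbardGridSub L M β (2 * (2 * M)))
                      (hubbardGridInteraction L (2 * (2 * M)) β U + hubbardGridCounterQuadratic L (2 * (2 * M)) β K))) m' Y
                else 0)) -
          grassmannLaplacian ℂ
            (Matrix.fromBlocks ((sectorSubMatrix L M β Ft).transpose * hubbardCovSliceCT L M β μ 0 K (klScale klE0 (j + 1)) (klScale klE0 j) *
                sectorSubMatrix L M β Ft) (0 : Matrix (SpaceTimeIdx L M × SectorLeg N) ρ ℂ)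
              (0 : Matrix ρ (SpaceTimeIdx L M × SectorLeg N) ℂ) (0 : Matrix ρ ρ ℂ))
            (∑ m' ∈ range (Fintype.card ((SpaceTimeIdx L M × SectorLeg N) ⊕ ρ) + 1), presented ℂ
              (fun Y : Fin m' → (SpaceTimeIdx L M × SectorLeg N) ⊕ ρ =>
                if ((univ : Finset (Fin m')).filter (fun i => (Y i).isRight)).card ≤ k then
                  kernel ℂ (ExteriorAlgebra.map (Matrix.toLin' (Matrix.fromRows
                      ((((imagTimeWeight β M : ℝ) : ℂ)) • sectorAnalysisMatrix L M β F * hubbardGridSub L M β (2 * (2 * M)))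
                      (Matrix.of fun b q => if p b = q then (1 : ℂ) else 0)))
                    (effAction ℂ ((hubbardGridSub L M β (2 * (2 * M))).transpose *
                        hubbardCovAboveCT L M β μ 0 K (klScale klE0 j) * hubbardGridSub L M β (2 * (2 * M)))
                      (hubbardGridInteraction L (2 * (2 * M)) β U + hubbardGridCounterQuadratic L (2 * (2 * M)) β K))) m' Y
                else 0))) m (Sum.inr ∘ a) +
      kernel ℂ (effAction ℂ
            (Matrix.fromBlocks ((sectorSubMatrix L M β Ft).transpose * hubbardCovSliceCT L M β μ 0 K (klScale klE0 (j + 1)) (klScale klE0 j) *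
                sectorSubMatrix L M β Ft) (0 : Matrix (SpaceTimeIdx L M × SectorLeg N) ρ ℂ)
              (0 : Matrix ρ (SpaceTimeIdx L M × SectorLeg N) ℂ) (0 : Matrix ρ ρ ℂ))
            (∑ m' ∈ range (Fintype.card ((SpaceTimeIdx L M × SectorLeg N) ⊕ ρ) + 1), presented ℂ
              (fun Y : Fin m' → (SpaceTimeIdx L M × SectorLeg N) ⊕ ρ =>
                if ((univ : Finset (Fin m')).filter (fun i => (Y i).isRight)).card ≤ k then
                  kernel ℂ (ExteriorAlgebra.map (Matrix.toLin' (Matrix.fromRows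
                      ((((imagTimeWeight β M : ℝ) : ℂ)) • sectorAnalysisMatrix L M β F * hubbardGridSub L M β (2 * (2 * M)))
                      (Matrix.of fun b q => if p b = q then (1 : ℂ) else 0)))
                    (effAction ℂ ((hubbardGridSub L M β (2 * (2 * M))).transpose *
                        hubbardCovAboveCT L M β μ 0 K (klScale klE0 j) * hubbardGridSub L M β (2 * (2 * M)))
                      (hubbardGridInteraction L (2 * (2 * M)) β U + hubbardGridCounterQuadratic L (2 * (2 * M)) β K))) m' Y
                else 0)) -
          gaussConv ℂ
            (Matrix.fromBlocks ((sectorSubMatrix L M β Ft).transpose * hubbardCovSliceCT L M β μ 0 K (klScale klE0 (j + 1)) (klScale klE0 j) *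
                sectorSubMatrix L M β Ft) (0 : Matrix (SpaceTimeIdx L M × SectorLeg N) ρ ℂ)
              (0 : Matrix ρ (SpaceTimeIdx L M × SectorLeg N) ℂ) (0 : Matrix ρ ρ ℂ))
            (∑ m' ∈ range (Fintype.card ((SpaceTimeIdx L M × SectorLeg N) ⊕ ρ) + 1), presented ℂ
              (fun Y : Fin m' → (SpaceTimeIdx L M × SectorLeg N) ⊕ ρ =>
                if ((univ : Finset (Fin m')).filter (fun i => (Y i).isRight)).card ≤ k then
                  kernel ℂ (ExteriorAlgebra.map (Matrix.toLin' (Matrix.fromRows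
                      ((((imagTimeWeight β M : ℝ) : ℂ)) • sectorAnalysisMatrix L M β F * hubbardGridSub L M β (2 * (2 * M)))
                      (Matrix.of fun b q => if p b = q then (1 : ℂ) else 0)))
                    (effAction ℂ ((hubbardGridSub L M β (2 * (2 * M))).transpose *
                        hubbardCovAboveCT L M β μ 0 K (klScale klE0 j) * hubbardGridSub L M β (2 * (2 * M)))
                      (hubbardGridInteraction L (2 * (2 * M)) β U + hubbardGridCounterQuadratic L (2 * (2 * M)) β K))) m' Y
                else 0))) m (Sum.inr ∘ a) := by
  set B := Matrix.fromBlocks ((sectorSubMatrix L M β Ft).transpose * hubbardCovSliceCT L M β μ 0 K (klScale klE0 (j + 1)) (klScale klE0 j) *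
      sectorSubMatrix L M β Ft) (0 : Matrix (SpaceTimeIdx L M × SectorLeg N) ρ ℂ) (0 : Matrix ρ (SpaceTimeIdx L M × SectorLeg N) ℂ)
      (0 : Matrix ρ ρ ℂ) with hB
  set V := ExteriorAlgebra.map (Matrix.toLin' (Matrix.fromRows
      ((((imagTimeWeight β M : ℝ) : ℂ)) • sectorAnalysisMatrix L M β F * hubbardGridSub L M β (2 * (2 * M)))
      (Matrix.of fun b q => if p b = q then (1 : ℂ) else 0)))
    (effAction ℂ ((hubbardGridSub L M β (2 * (2 * M))).transpose *
        hubbardCovAboveCT L M β μ 0 K (klScale klE0 j) * hubbardGridSub L M β (2 * (2 * M)))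
      (hubbardGridInteraction L (2 * (2 * M)) β U + hubbardGridCounterQuadratic L (2 * (2 * M)) β K)) with hV
  have hC' : ∀ X Y, B X Y ≠ 0 → X.isLeft ∧ Y.isLeft := fun X Y h => noSpectatorLine_fromBlocks_zero ℂ _ X Y (by rw [hB] at h; exact h)
  have hZa : ((univ : Finset (Fin m)).filter (fun i => ((Sum.inr ∘ a : Fin m → (SpaceTimeIdx L M × SectorLeg N) ⊕ ρ) i).isRight)).card ≤ k := by
    rw [card_filter_isRight_inr_comp]; exact hmk
  rw [kernel_gridEffAction_succ_sub_eq_spectator_family hβ U μ K j hZ F Ft hFF hCpl p m a, ← hB, ← hV]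
  -- each piece sees only the truncated vertex
  have h1 := kernel_grassmannLaplacian_eq_kernel_grassmannLaplacian_spectatorTrunc ℂ B hC' k V m (Sum.inr ∘ a) hZa
  have h2 := kernel_gaussConv_eq_kernel_gaussConv_spectatorTrunc ℂ B hC' k V m (Sum.inr ∘ a) hZa
  have h3 := kernel_effAction_eq_kernel_effAction_spectatorTrunc ℂ B hC' k V m (Sum.inr ∘ a) hZa
  have h0 := kernel_eq_kernel_spectatorTrunc ℂ k V m (Sum.inr ∘ a) hZa
  rw [kernel_sub_gen, kernel_sub_gen, kernel_sub_gen, h1, h2, h3, h0]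
  rw [kernel_sub_gen, kernel_sub_gen, kernel_sub_gen]

end Model

end Summit.HubbardSuperconductivity.HubbardSuperconductivity.Theorems.EngineV8

end
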